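import Summits.Ventures.DiscreteObjects.UnitDistance.MultiquadraticCriterion

/-!
# Field planes under the 2-adic criterion: `χ(ℚ²) = 2`, `χ(ℚ(√2)²) = 2`, bipartite and four-colour multiquadratic planes
(cell `pub-namedobj`, target (U), seat udg g11)

Framing (verbatim for the cell): lottery ticket; floor = certified bounds/negative ranges.

Plane forms of U2-COMPLETE (`MultiquadraticCriterion`): for a subfield `K ⊆ ℝ`, `fieldPoints K = K² ⊂ ℝ²` and
`χ(K²) := χ(planeUnitDistanceGraph.induce (fieldPoints K))`.

* `chromaticNumber_plane_eq_two` — `χ(ℚ(√d : d ∈ S)²) = 2` for every ramified pattern `S` (classes in `⟨[2],[5]⟩` or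
  `⟨[−2],[5]⟩`); `colorable_four_plane_of_squareClasses` — `χ ≤ 4` for all four patterns.
* `chromaticNumber_plane_rat` — WOODALL 1973: `χ(ℚ²) = 2` (kernel; replication); `chromaticNumber_plane_sqrt_eq_two` —
  JOHNSON 1987: `χ(ℚ(√n)²) = 2` for `n ≡ 1, 2 (mod 4)` (kernel; replication; `n = 2` is Madore 2015 Prop. 3.6 and Soifer's
  Open Problem 11.6 attributed to Benda–Perles).
* `three_le_of_sqrt3_mem` / `chromaticNumber_plane_eq_four_of_moser` — lower bounds inside the criterion: a triangle when
  `√3 ∈ K`, the Moser spindle when `√3, √11 ∈ K`; e.g. `χ(ℚ(√3, √11, √14)²) = 4`, `χ(ℚ(√3, √10, √11, √19)²) = 4`.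
* `squareClass_criterion_summary` — one conjunction for the table.

Nothing here is literature; the quadratic values are replications (citations in the docstrings), the multiquadratic
ones were not found in print (novelty PROVISIONAL, see `MultiquadraticCriterion`).
-/

noncomputable section

namespace Summit.Ventures.DiscreteObjects.UnitDistance

open MoserLocal SimpleGraph IntermediateField Literature.Combinatorics.SimpleGraph.MoserMoser1961
open scoped IntermediateField

/-! ## The criterion, plane form -/

/-- FOUR COLOURS (plane form): `χ(ℚ(√d : d ∈ S)²) ≤ 4` whenever the square classes of `S` avoid `[−1]`. -/
theorem colorable_four_plane_of_squareClasses (S : Finset ℕ) (hS : SquareClassesAvoidNegOne S) :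
    (planeUnitDistanceGraph.induce (fieldPoints (multiSqrtField S))).Colorable 4 :=
  colorable_four_of_realisation_in_squareClasses S hS (isUnitDistanceRealisation_fieldPoints _) fun q i => q.2 i

/-- TWO COLOURS (plane form): `ℚ(√d : d ∈ S)²` is bipartite whenever the square classes of `S` avoid `[−1]` and `[3]`. -/
theorem colorable_two_plane_of_squareClasses (S : Finset ℕ) (hS : SquareClassesAvoidNegOneAndThree S) :
    (planeUnitDistanceGraph.induce (fieldPoints (multiSqrtField S))).Colorable 2 :=
  colorable_two_of_realisation_in_squareClasses S hS (isUnitDistanceRealisation_fieldPoints _) fun q i => q.2 i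

/-- `χ(ℚ(√d : d ∈ S)²) = 2` EXACTLY for every ramified pattern `S`.  Examples: `S = {5}`, `{6}`, `{10}`, `{13}`, `{14}`,
`{2, 5, 13, 17, 26}`, `{5, 6, 13, 14, 21, 30}`. -/
theorem chromaticNumber_plane_eq_two (S : Finset ℕ) (hS : SquareClassesAvoidNegOneAndThree S) :
    (planeUnitDistanceGraph.induce (fieldPoints (multiSqrtField S))).chromaticNumber = 2 := by
  rw [show (2 : ℕ∞) = (1 : ℕ) + 1 by norm_num]
  exact chromaticNumber_eq_iff_colorable_not_colorable.mpr
    ⟨colorable_two_plane_of_squareClasses S hS, not_colorable_one_plane _⟩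

/-! ## Woodall 1973 and Johnson 1987 in the kernel -/

/-- WOODALL 1973 (kernel; replication of D. R. Woodall, *Distances realized by sets covering the plane*, JCT A 14 (1973);
Soifer 2009 §11.2): the unit-distance graph of the RATIONAL PLANE `ℚ²` has chromatic number exactly `2`. -/
theorem chromaticNumber_plane_rat :
    (planeUnitDistanceGraph.induce (fieldPoints (⊥ : IntermediateField ℚ ℝ))).chromaticNumber = 2 := by
  rw [show (2 : ℕ∞) = (1 : ℕ) + 1 by norm_num]
  refine chromaticNumber_eq_iff_colorable_not_colorable.mpr ⟨?_, not_colorable_one_plane _⟩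
  exact colorable_plane_of_le bot_le (colorable_two_plane_of_squareClasses ∅ (by decide))

/-- Algebraic form of Woodall's theorem: `χ(unitCircleGraph ℚ) = 2`. -/
theorem chromaticNumber_unitCircleGraph_rat : (unitCircleGraph ℚ).chromaticNumber = 2 := by
  rw [show (2 : ℕ∞) = (1 : ℕ) + 1 by norm_num]
  refine chromaticNumber_eq_iff_colorable_not_colorable.mpr ⟨?_, not_colorable_one_unitCircleGraph ℚ⟩
  exact unitCircleGraph_colorable_of_ringHom (algebraMap ℚ (multiSqrtField ∅))
    (colorable_two_of_squareClasses ∅ (by decide) (G := unitCircleGraph (multiSqrtField ∅)) Prod.fst Prod.snd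
      fun _ _ h => h.2)

/-- JOHNSON 1987 (kernel; replication of P. D. Johnson, Congr. Numer. 60 (1987) 51–58, as quoted in Payne 2009
arXiv:0707.1177 p. 6 — here without the square-free hypothesis): `χ(ℚ(√n)²) = 2` for every `n ≡ 1, 2 (mod 4)`.
The case `n = 2` is Madore 2015 (arXiv:1509.07023) Prop. 3.6 and Soifer 2009 Open Problem 11.6 (Benda–Perles). -/
theorem chromaticNumber_plane_sqrt_eq_two (n : ℕ) (hn : n % 4 = 1 ∨ n % 4 = 2) :
    (planeUnitDistanceGraph.induce (fieldPoints ℚ⟮Real.sqrt n⟯)).chromaticNumber = 2 := by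
  rw [← multiSqrtField_singleton]
  apply chromaticNumber_plane_eq_two
  unfold SquareClassesAvoidNegOneAndThree
  simp only [Finset.mem_singleton, forall_eq]
  omega

/-- In particular `χ(ℚ(√2)²) = 2` (Soifer's Open Problem 11.6; Johnson 1987, Madore 2015 Prop. 3.6). -/
theorem chromaticNumber_plane_sqrt2 :
    (planeUnitDistanceGraph.induce (fieldPoints ℚ⟮Real.sqrt 2⟯)).chromaticNumber = 2 :=
  chromaticNumber_plane_sqrt_eq_two 2 (by norm_num)

/-- …and `χ(ℚ(√5)²) = 2` (the golden-ratio field: Johnson's case `n ≡ 1 mod 4`). -/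
theorem chromaticNumber_plane_sqrt5 :
    (planeUnitDistanceGraph.induce (fieldPoints ℚ⟮Real.sqrt 5⟯)).chromaticNumber = 2 :=
  chromaticNumber_plane_sqrt_eq_two 5 (by norm_num)

/-! ## Exact value four: the Moser spindle inside the criterion -/

/-- `χ(ℚ(√d : d ∈ S)²) = 4` EXACTLY when the square classes of `S` avoid `[−1]` and `3, 11 ∈ S`.  Examples beyond U1:
`S = {3, 11, 14}`, `{3, 10, 11, 19, 30}` (pattern `⟨[−2],[3]⟩`), `{2, 3, 6, 11, 22}` (pattern `⟨[2],[3]⟩`, udg g10). -/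
theorem chromaticNumber_plane_eq_four_of_moser (S : Finset ℕ) (hS : SquareClassesAvoidNegOne S) (h3 : 3 ∈ S)
    (h11 : 11 ∈ S) : (planeUnitDistanceGraph.induce (fieldPoints (multiSqrtField S))).chromaticNumber = 4 := by
  rw [show (4 : ℕ∞) = (3 : ℕ) + 1 by norm_num]
  refine chromaticNumber_eq_iff_colorable_not_colorable.mpr ⟨colorable_four_plane_of_squareClasses S hS, ?_⟩
  refine not_colorable_three_plane_of_moser _ ?_ ?_
  · simpa using sqrt_mem_multiSqrtField (S := S) (d := 3) h3
  · simpa using sqrt_mem_multiSqrtField (S := S) (d := 11) h11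

/-- Example beyond print: `χ(ℚ(√3, √11, √14)²) = 4` (the field `ℚ₂(√−2, √3)`, pattern `⟨[−2],[3]⟩`). -/
theorem chromaticNumber_plane_sqrt3_sqrt11_sqrt14 :
    (planeUnitDistanceGraph.induce (fieldPoints (multiSqrtField {3, 11, 14}))).chromaticNumber = 4 :=
  chromaticNumber_plane_eq_four_of_moser _ (by decide) (by decide) (by decide)

/-- Example beyond print: `χ(ℚ(√2, √5, √13, √17, √26)²) = 2` (pattern `⟨[2],[5]⟩`). -/
theorem chromaticNumber_plane_example_25 :
    (planeUnitDistanceGraph.induce (fieldPoints (multiSqrtField {2, 5, 13, 17, 26}))).chromaticNumber = 2 :=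
  chromaticNumber_plane_eq_two _ (by decide)

/-- Example beyond print: `χ(ℚ(√5, √6, √13, √14, √21, √30)²) = 2` (pattern `⟨[−2],[5]⟩`). -/
theorem chromaticNumber_plane_example_m25 :
    (planeUnitDistanceGraph.induce (fieldPoints (multiSqrtField {5, 6, 13, 14, 21, 30}))).chromaticNumber = 2 :=
  chromaticNumber_plane_eq_two _ (by decide)

/-! ## Summary -/

/-- U2-COMPLETE, ONE CONJUNCTION FOR THE TABLE.  (i) `χ(K_S²) ≤ 4` for every `S` whose 2-adic square classes avoid
`[−1]` (four patterns); (ii) `χ(K_S²) = 2` for every `S` whose classes avoid `[−1]` and `[3]` (two patterns); (iii) in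
particular `χ(ℚ²) = 2` (Woodall 1973) and `χ(ℚ(√n)²) = 2` for all `n ≡ 1, 2 (mod 4)` (Johnson 1987); (iv) `χ(K_S²) = 4`
when moreover `3, 11 ∈ S`; (v) every unit-distance graph that is not `4`-colourable — every 5-chromatic one and any
hypothetical 6-chromatic witness of target (U) — has a coordinate outside every such `K_S`. -/
theorem squareClass_criterion_summary :
    (∀ S : Finset ℕ, SquareClassesAvoidNegOne S →
        (planeUnitDistanceGraph.induce (fieldPoints (multiSqrtField S))).Colorable 4) ∧
    (∀ S : Finset ℕ, SquareClassesAvoidNegOneAndThree S →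
        (planeUnitDistanceGraph.induce (fieldPoints (multiSqrtField S))).chromaticNumber = 2) ∧
    (planeUnitDistanceGraph.induce (fieldPoints (⊥ : IntermediateField ℚ ℝ))).chromaticNumber = 2 ∧
    (∀ n : ℕ, n % 4 = 1 ∨ n % 4 = 2 →
        (planeUnitDistanceGraph.induce (fieldPoints ℚ⟮Real.sqrt n⟯)).chromaticNumber = 2) ∧
    (∀ S : Finset ℕ, SquareClassesAvoidNegOne S → 3 ∈ S → 11 ∈ S →
        (planeUnitDistanceGraph.induce (fieldPoints (multiSqrtField S))).chromaticNumber = 4) ∧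
    (∀ (V : Type) (G : SimpleGraph V) (p : V → EuclideanSpace ℝ (Fin 2)), IsUnitDistanceRealisation G p →
        ¬ G.Colorable 4 → ∀ S : Finset ℕ, SquareClassesAvoidNegOne S → ∃ v i, p v i ∉ multiSqrtField S) :=
  ⟨colorable_four_plane_of_squareClasses, chromaticNumber_plane_eq_two, chromaticNumber_plane_rat,
    chromaticNumber_plane_sqrt_eq_two, chromaticNumber_plane_eq_four_of_moser,
    fun _ _ _ hp h4 => (leaves_squareClass_fields hp).1 h4⟩

end Summit.Ventures.DiscreteObjects.UnitDistance
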